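import Summits.AtomisticToContinuum.HydrodynamicLimit.Theses.WarmColdCarving
import Literature.Analysis.FluidPDE.HardSphereAlexander
import Literature.MathematicalPhysics.KineticTheory.HardSphereEulerProofs

/-!
Refutation of `WarmColdCarving.ColdIsRare` (item stmt-AtomisticToContinuum-6610).

The statement quantifies over ALL ball radii `ℓ > 0` and density fractions `α > 0`.  When
`α · (4/3) π ℓ³ ≤ 1` (e.g. `ℓ = 1/2`, `α = 1`) the sub-population `S = {i}` is admissible for every
particle `i`: it lies in the ball of `i`, has `|S| = 1 ≥ α (4/3) π ℓ³`, and its empirical velocity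
variance in any direction is `0 ≤ δ² θe`.  Hence EVERY particle is "cold" in EVERY configuration, the
cold fraction is identically `1 > β = 1/2`, the event is the whole phase space, and the homogeneous
Gibbs law (a probability measure for `σ ≤ 1/2`, `isProbabilityMeasure_localGibbsLaw`) gives it mass
`1 > exp (-(N+1))`.  A hard-sphere flow to instantiate `∀ Φ` exists by Alexander's theorem on the torus
(`HardSphereFlow.nonempty_torus_holds`).  (More generally any `|S| ≤ 3` velocities in `ℝ³` have a
direction of zero empirical variance, so the statement needs the side condition `3 < α (4/3) π ℓ³`.)
-/

namespace Summit.AtomisticToContinuum.HydrodynamicLimit.Theorems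

open MeasureTheory
open Literature.Analysis.FluidPDE Literature.MathematicalPhysics.KineticTheory

/-- Refutes `WarmColdCarving.ColdIsRare`: with `ℓ = 1/2`, `α = 1` every singleton sub-population is
cold, so the cold fraction is identically `1` and the event has Gibbs probability `1 > e^{-(N+1)}`;
witness flow from Alexander's theorem. [folklore] -/
theorem WarmColdCarvingColdIsRare_refuted :
    ¬ Summit.AtomisticToContinuum.HydrodynamicLimit.Theses.WarmColdCarving.ColdIsRare := by
  rintro ⟨σ₀, hσ₀, h⟩
  set σ : ℝ := min (σ₀ / 2) (1 / 4) with hσdef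
  have hσpos : 0 < σ := lt_min (by linarith) (by norm_num)
  have hσlt : σ < σ₀ := lt_of_le_of_lt (min_le_left _ _) (by linarith)
  have hσle : σ ≤ 1 / 4 := min_le_right _ _
  obtain ⟨δ₀, hδ₀, h2⟩ :=
    h σ hσpos hσlt 1 one_pos (1 / 2) 1 (1 / 2) (by norm_num) one_pos (by norm_num) 1
  obtain ⟨N₀, h3⟩ := h2 δ₀ hδ₀ le_rfl
  have hεpos : 0 < hsDiameter σ N₀ := hsDiameter_pos hσpos N₀
  have hεlt : hsDiameter σ N₀ < 2⁻¹ := by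
    have := hsDiameter_le hσpos.le N₀
    linarith
  obtain ⟨Φ⟩ := HardSphereFlow.nonempty_torus_holds (d := Fin 3) hεpos hεlt (N₀ + 1)
  have h4 := h3 N₀ le_rfl Φ
  have key : ∀ {f : Fin (N₀ + 1) → ℝ} {b : ℝ}, b < 1 → (∀ i, f i = 1) →
      b < ((N₀ : ℝ) + 1)⁻¹ * ∑ i : Fin (N₀ + 1), f i := by
    intro f b hb hf
    have hs : ∑ i : Fin (N₀ + 1), f i = (N₀ : ℝ) + 1 := by
      simp [hf]
    rw [hs, inv_mul_cancel₀ (by positivity)]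
    exact hb
  haveI hprob : IsProbabilityMeasure
      (localGibbsLaw σ (fun _ => 1) (fun _ => 0) (fun _ => (1 : ℝ)) N₀ Φ) :=
    isProbabilityMeasure_localGibbsLaw continuous_const continuous_const continuous_const
      (fun _ => one_pos) (fun _ => one_pos) (by linarith) N₀ Φ
  have hle : (localGibbsLaw σ (fun _ => 1) (fun _ => 0) (fun _ => (1 : ℝ)) N₀ Φ) Set.univ
      ≤ ENNReal.ofReal (Real.exp (-(1 * ((N₀ : ℝ) + 1)))) := by
    refine le_trans (measure_mono fun z _ => ?_) h4
    simp only [Set.mem_setOf_eq]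
    refine key (by norm_num) fun i => ?_
    refine if_pos ⟨{i}, ?_, ?_, ?_⟩
    · intro j hj
      rw [Finset.mem_singleton] at hj
      subst hj
      simp only [Finset.mem_filter, Finset.mem_univ, true_and, Torus.euclidDist_self]
      positivity
    · have hπ := Real.pi_le_four
      simp only [Finset.card_singleton, Nat.cast_one]
      nlinarith
    · refine ⟨EuclideanSpace.single 0 1, by simp, ?_⟩
      simp only [Finset.sum_singleton, Finset.card_singleton, Nat.cast_one, inv_one, one_mul,
        sub_self]
      first
        | positivity
        | (norm_num; done)
        | (norm_num; positivity)
  have hlt : ENNReal.ofReal (Real.exp (-(1 * ((N₀ : ℝ) + 1)))) < 1 := by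
    rw [ENNReal.ofReal_lt_one]
    exact Real.exp_lt_one_iff.2 (by nlinarith [(Nat.cast_nonneg N₀ : (0 : ℝ) ≤ N₀)])
  rw [measure_univ] at hle
  exact absurd (lt_of_le_of_lt hle hlt) (lt_irrefl 1)

end Summit.AtomisticToContinuum.HydrodynamicLimit.Theorems
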